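import Mathlib
import Literature.Probability.Process.PointStationaryTransfer
import Literature.Probability.Process.RootedHardCoreConfig
import Literature.MathematicalPhysics.StatisticalMechanics.BarlowStacking

/-!
# `ChartedPlanarOrder` · crux `ChartedZeroExcessLayered` (stmt-AtomisticToContinuum-26636) · node «CoerciveStraightening»
# — the TRUE-type piece U₂ `ExactShowsEverywhere`, PROVED

decomp-a2c · lens-3 · generation 11 (planner seat `decomp-a2c-lens-3-g11`, 2026-08-30), filed with the node
«CoerciveStraightening» (N ⟸ C ∧ X ∧ U₁ ∧ U₂; HOME/decomp-a2c-lens-3/g11/node2/NodeCoerciveStraightening.lean) under the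
critic's RULING ν(i) (CRITIC-LEDGER row 129).

CONTENT.  `exactShowsEverywhere` is VERBATIM the piece `CoerciveStraightening.ExactShowsEverywhere` of the node: for a
probability law `P` on configurations carried by rooted `δ`-separated counting measures and satisfying the Mecke /
mass-transport identity, if `P`-a.s. the configuration is EXACTLY a flexible-gap layered Barlow pattern
`q + S(A,a,s,z)` inside radius `3a` around the root `q = 0`, then `P`-a.s. it is so around EVERY point `q` of the
configuration (pattern re-centred at `q`; the conclusion is the conclusion clause of
`ChartedPlanarOrder.ChartedZeroExcessLayered` for the scale `a`).

PROOF.  Aldous–Lyons «everything shows at the root» in Mecke form — the ROUTE-INDEPENDENT Literature engine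
`Literature.Probability.Process.IsPointStationaryLaw.ae_forall_map_sub` (local finiteness of the norm shells from the
hard core via `LocalConfig.finite_inter_of_separated`) — applied to the root-exactness property, followed by the
translation covariance `(θ_q μ){y} = μ{y + q}` (`Measure.map_apply`).  Same engine and shape as the landed
`ChartedPlanarOrderEveryPointOfRoot.stub_everyPointOfRoot` (p781065).  No new definitions; no Theses import
(theses-cone clean); axioms standard.
-/

namespace Summit.AtomisticToContinuum.Crystallization.Theorems.ChartedPlanarOrderExactShowsEverywhere

open MeasureTheory

/-- **Exactness shows everywhere** (= piece U₂ `ExactShowsEverywhere` of node «CoerciveStraightening» on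
stmt-AtomisticToContinuum-26636, verbatim): a.s. exactly layered at the root ⟹ a.s. exactly layered at every point.
[AldousLyons2007, Lemma 2.3; engine `IsPointStationaryLaw.ae_forall_map_sub`] -/
theorem exactShowsEverywhere :
    ∀ a : ℝ, 0 < a → ∀ δ : ℝ, 0 < δ → ∀ P : MeasureTheory.Measure (MeasureTheory.Measure (EuclideanSpace ℝ (Fin 3))), MeasureTheory.IsProbabilityMeasure P → (∀ᵐ μ ∂P, (∃ S : Set (EuclideanSpace ℝ (Fin 3)), (0 : EuclideanSpace ℝ (Fin 3)) ∈ S ∧ (∀ x ∈ S, ∀ y ∈ S, x ≠ y → δ ≤ dist x y) ∧ μ = (MeasureTheory.Measure.count : MeasureTheory.Measure (EuclideanSpace ℝ (Fin 3))).restrict S)) → (∀ g : MeasureTheory.Measure (EuclideanSpace ℝ (Fin 3)) → EuclideanSpace ℝ (Fin 3) → ENNReal, Measurable (Function.uncurry g) → ∫⁻ μ, ∫⁻ y, g μ y ∂μ ∂P = ∫⁻ μ, ∫⁻ y, g (MeasureTheory.Measure.map (fun z => z - y) μ) (-y) ∂μ ∂P) → (∀ᵐ μ ∂P, ∃ (A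 : EuclideanSpace ℝ (Fin 3) →ₗᵢ[ℝ] EuclideanSpace ℝ (Fin 3)) (s : ℤ → ℤ) (z : ℤ → ℝ), Literature.MathematicalPhysics.StatisticalMechanics.IsHaggSeq s ∧ (∀ m : ℤ, 39 / 50 * a ≤ z (m + 1) - z m ∧ z (m + 1) - z m ≤ 17 / 20 * a) ∧ z 0 = 0 ∧ ∀ y : EuclideanSpace ℝ (Fin 3), dist y (0 : EuclideanSpace ℝ (Fin 3)) ≤ 3 * a → (μ {y} ≠ 0 ↔ y - (0 : EuclideanSpace ℝ (Fin 3)) ∈ {p | ∃ m i j : ℤ, p = A (((i : ℝ) • Literature.MathematicalPhysics.StatisticalMechanics.triangularVec₁ a) + ((j : ℝ) • Literature.MathematicalPhysics.StatisticalMechanics.triangularVec₂ a) + ((Literature.MathematicalPhysics.StatisticalMechanics.haggLabel s m : ℝ) • Literature.MathematicalPhysics.StatisticalMechanics.barlowOffset a) + (z m • Literature.MathematicalPhysics.StatisticalMechanics.layerNormal 1))})) → ∀ᵐ μ ∂P, ∀ q : EuclideanSpace ℝ (Fin 3), μ {q} ≠ 0 → ∃ (A : EuclideanSpace ℝ (Fin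 3) →ₗᵢ[ℝ] EuclideanSpace ℝ (Fin 3)) (s : ℤ → ℤ) (z : ℤ → ℝ), Literature.MathematicalPhysics.StatisticalMechanics.IsHaggSeq s ∧ (∀ m : ℤ, 39 / 50 * a ≤ z (m + 1) - z m ∧ z (m + 1) - z m ≤ 17 / 20 * a) ∧ z 0 = 0 ∧ ∀ y : EuclideanSpace ℝ (Fin 3), dist y q ≤ 3 * a → (μ {y} ≠ 0 ↔ y - q ∈ {p | ∃ m i j : ℤ, p = A (((i : ℝ) • Literature.MathematicalPhysics.StatisticalMechanics.triangularVec₁ a) + ((j : ℝ) • Literature.MathematicalPhysics.StatisticalMechanics.triangularVec₂ a) + ((Literature.MathematicalPhysics.StatisticalMechanics.haggLabel s m : ℝ) • Literature.MathematicalPhysics.StatisticalMechanics.barlowOffset a) + (z m • Literature.MathematicalPhysics.StatisticalMechanics.layerNormal 1))}) := by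
  intro a ha δ hδ P hP hroot hmecke hex
  -- local finiteness of the norm shells, from the hard core
  have hlf : ∀ᵐ μ ∂P, ∀ n : ℕ, μ ((fun z : EuclideanSpace ℝ (Fin 3) => ⌊‖z‖⌋₊) ⁻¹' {n}) < ⊤ := by
    filter_upwards [hroot] with μ hμ
    obtain ⟨S, -, hsep, rfl⟩ := hμ
    intro n
    rw [MeasureTheory.Measure.restrict_apply (Literature.Probability.Process.measurableSet_floorNorm_preimage n)]
    refine (MeasureTheory.measure_mono ?_).trans_lt (MeasureTheory.Measure.count_apply_lt_top.2
      (Literature.Probability.Process.LocalConfig.finite_inter_of_separated hδ hsep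
        (isCompact_closedBall (0 : EuclideanSpace ℝ (Fin 3)) ((n : ℝ) + 1))))
    rintro w ⟨hw, hwS⟩
    exact ⟨Literature.Probability.Process.floorNorm_preimage_subset_closedBall n hw, hwS⟩
  -- Aldous–Lyons: root exactness holds re-rooted at every point, a.s.
  have hstat : Literature.Probability.Process.IsPointStationaryLaw P := hmecke
  have key := hstat.ae_forall_map_sub hlf hex
  filter_upwards [key] with μ hμ q hq
  obtain ⟨A, s, z, hs, hgap, hz0, hiff⟩ := hμ q hq
  have hmap : ∀ y : EuclideanSpace ℝ (Fin 3),
      (MeasureTheory.Measure.map (fun w => w - q) μ) {y} = μ {y + q} := by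
    intro y
    rw [MeasureTheory.Measure.map_apply (measurable_sub_const q) (measurableSet_singleton y)]
    congr 1
    ext w
    simp only [Set.mem_preimage, Set.mem_singleton_iff, sub_eq_iff_eq_add]
  refine ⟨A, s, z, hs, hgap, hz0, fun y hyq => ?_⟩
  have hd0 : dist (y - q) (0 : EuclideanSpace ℝ (Fin 3)) ≤ 3 * a := by
    simpa [dist_eq_norm] using hyq
  have h := hiff (y - q) hd0
  rw [hmap, sub_add_cancel, sub_zero] at h
  exact h

end Summit.AtomisticToContinuum.Crystallization.Theorems.ChartedPlanarOrderExactShowsEverywhere
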